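import Mathlib.Data.Fintype.Pigeonhole
import Literature.NumberTheory.EllipticCurves.IsogenyClassFiniteProofs
import Literature.NumberTheory.EllipticCurves.IsogenyNotRationalCMProofs
import Literature.NumberTheory.EllipticCurves.IsogenyQuotientCurveProofs
import Literature.NumberTheory.EllipticCurves.IsogenyCompProofs
import Literature.NumberTheory.EllipticCurves.IsogenyIdProofs
import Literature.NumberTheory.EllipticCurves.IsogenyVariableChangeProofs
import Literature.NumberTheory.EllipticCurves.MazurTorsionGaloisStructureProofs
import HarnessLib

/-!
# Mazur 1977, Ch. III §5, the Second reduction — proved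

Topic `Literature/NumberTheory/EllipticCurves`. Sixth sibling proof file (theorems only, no
definitions, no named facts, no `sorry`) of the vocabulary file `MazurTorsion.lean`, serving the
prime-case leaf `Literature.NumberTheory.EllipticCurves.Mazur1977_no_prime_torsion W` (B. Mazur,
*Modular curves and the Eisenstein ideal*, Publ. Math. IHÉS 47 (1977), Ch. III §5, pp. 156–160).
After `MazurTorsionGaloisStructureProofs.lean` (the Galois set-up of p. 157: (5.4), the Borel
shape, "(5.4) splits iff `L = K`") and `MazurTorsionLocalStepsProofs.lean` (Steps 1–2), this file
PROVES the **Second reduction** (pp. 157–158):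

> "Second reduction. — It suffices to prove that (5.4) splits, or equivalent, that `L = K`. For
> we would then have the following result from which we easily derive a contradiction: Given any
> elliptic curve `ℰ` and a sub-Galois module `ℤ/N ⊂ ℰ`, there is a sub-Galois module `μ_N ⊂ ℰ`.
> … Forming the quotient `ℰ' = ℰ/μ_N` … we obtain a chain of such elliptic curves over `ℚ`,
> related by `μ_N`-isogenies, rational over `ℚ`: `ℰ → ℰ' → ℰ'' → ⋯` … the members of the above
> chain cannot be all mutually nonisomorphic … This would contradict the theorem of Shafarevitch
> … consequently there is a non-scalar endomorphism of `ℰ^{(i)}` defined over `ℚ` … complex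
> multiplication over `ℚ`, which is impossible."

* `exists_quotient_step` — one link `ℰ → ℰ' = ℰ/μ_N`: for `Q ∈ ℰ[N] ∖ {O}` fixed by `Γ_ℚ` and a
  `Γ_ℚ`-stable complement `C` of `⟨Q⟩` ("`μ_N`"), the quotient by `C` (the tree's PROVED
  `WeierstrassCurve.exists_isogeny_ker_eq_and_comp_eq_nsmul_holds`, Silverman *AEC* III.4.12 with
  III.4.13.2, file `IsogenyQuotientCurveProofs`) is an elliptic curve `ℰ'/ℚ` with a `ℚ`-isogeny
  `g : ℰ → ℰ'` such that `g Q ∈ ℰ'[N]` is again non-zero and `Γ_ℚ`-fixed, and `g` kills a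
  non-zero `N`-torsion point.
* `Mazur1977_secondReduction` — **the Second reduction**: if every elliptic curve `ℚ`-isogenous
  to `E` with a "`ℤ/N ⊂ ℰ`" admits a "`μ_N ⊂ ℰ`" complementing it (i.e. (5.4) splits for it),
  then `E(ℚ)` has no point of prime order `N`. The chain is built by dependent choice; two of its
  members are `ℚ`-isomorphic by **Shafarevich's theorem** in the form *AEC* Cor. IX.6.2 (the
  tree's PROVED `WeierstrassCurve.finite_isogenyClass_holds`, file `IsogenyClassFiniteProofs`,
  from Siegel's theorem); the resulting `ℚ`-endomorphism `ψ` of `ℰ^{(i)}` is a scalar `[n]` by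
  **"no complex multiplication over `ℚ`"** (the tree's PROVED
  `WeierstrassCurve.not_hasRationalCM_holds`, file `IsogenyNotRationalCMProofs`, Silverman
  *ATAEC* II.2.2), and "non-scalar" is witnessed on the `N`-torsion: `ψ` kills a non-zero point
  of `μ_N` (so `N ∣ n`, `ψ` kills `ℰ^{(i)}[N]`) yet maps `Q_i ↦ Q_j ≠ O` injectively.
* `Mazur1977_secondReduction_of_forall_smul_eq` — the same with the hypothesis in the form
  "`L = K`" (`Γ_{ℚ(ζ_N)} = ker χ̄_N` acts trivially on `ℰ[N]`), through
  `exists_stable_isCompl_zmultiples_iff`.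
* `Mazur1977_no_prime_torsion_of_forall_smul_eq` — **the prime-case leaf reduced to "`L = K`"**:
  `Mazur1977_no_prime_torsion W` follows once `Γ_{ℚ(ζ_N)}` acts trivially on `ℰ[N]` for every
  prime `N ∉ {2, 3, 5, 7, 13}` and every elliptic `ℰ/ℚ` isogenous to `W` carrying a "`ℤ/N`" —
  exactly the statement proved by the Third reduction (Herbrand) and Steps 1–4 (Néron models,
  Raynaud, `X₀(N)` and the Eisenstein quotient) on pp. 158–160, which remain out of reach.

Mazur's alternative to Shafarevich ("more in the spirit of the present work": infinitely many
rational points on `X₀(N)`, contradicting Thm. (4.1)) is not needed here.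

## References

* [Mazur1977] B. Mazur, *Modular curves and the Eisenstein ideal*, Publ. Math. IHÉS 47 (1977),
  Ch. III §5, pp. 157–158 (held: `paper:doi-10-1007-bf02684339`, PDF pp. 126–127; read).
* [SilvermanAEC2009] J. H. Silverman, *The Arithmetic of Elliptic Curves*, 2nd ed. (2009),
  Prop. III.4.12, Rem. III.4.13.2, Thm. IX.6.1 (Shafarevich), Cor. IX.6.2.
* [SilvermanAdvancedTopics1994] J. H. Silverman, *Advanced Topics in the Arithmetic of Elliptic
  Curves* (1994), Thm. II.2.2 (endomorphisms defined over `ℚ`).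

## Design

No definitions; `noncomputable section`, `open scoped Classical`. The chain lives in the subtype
of `Σ E : WeierstrassCurve ℚ, E[N]` cut out by "`E` elliptic, the point non-zero, `Γ_ℚ`-fixed, `E`
isogenous to `W`", with the one-link relation hiding the isogeny existentially, so that dependent
choice is a plain `Nat.rec` of `Classical.choose`; the isomorphism `ℰ^{(j)} = D • ℰ^{(i)}` is
turned into an injective isogeny back (`exists_injective_isogeny_of_smul_eq`, by `subst` on an
equality of curves and the tree's `VariableChange.toIsogeny`).
-/

noncomputable section

open scoped Classical

namespace Literature.NumberTheory.EllipticCurves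

open _root_.WeierstrassCurve Field

/-! ## §1 Two small lemmas on isogenies -/

section Lemmas

variable {K : Type*} [Field K]

/-- Equal Weierstrass curves are joined by an injective isogeny (the identity). [folklore] -/
theorem exists_injective_isogeny_of_eq {E₁ E₂ : WeierstrassCurve K} (h : E₁ = E₂) :
    ∃ ι : Isogeny E₁ E₂, Function.Injective ι := by
  subst h
  exact ⟨Isogeny.id E₁, fun a b hab ↦ by rwa [Isogeny.id_apply, Isogeny.id_apply] at hab⟩

/-- An injective isogeny `C • E → E` back from a change of variables: the inverse substitution
(Silverman, *AEC* III.3.1(b); the tree's `VariableChange.toIsogeny`). [folklore] -/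
theorem exists_injective_isogeny_of_smul_eq {E E' : WeierstrassCurve K} {C : VariableChange K}
    (h : C • E = E') : ∃ ι : Isogeny E' E, Function.Injective ι := by
  obtain ⟨ι₁, h₁⟩ := exists_injective_isogeny_of_eq h.symm
  obtain ⟨ι₂, h₂⟩ := exists_injective_isogeny_of_eq (inv_smul_smul C E)
  refine ⟨ι₂.comp ((VariableChange.toIsogeny (C • E) C⁻¹).comp ι₁), fun a b hab ↦ ?_⟩
  simp only [Isogeny.comp_apply] at hab
  exact h₁ (VariableChange.toIsogeny_injective _ _ (h₂ hab))

/-- An integer endomorphism `[n]` killing a non-zero `N`-torsion point, `N` prime, kills all the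
`N`-torsion (`N ∣ n`). [folklore] -/
theorem zsmul_eq_zero_of_zsmul_eq_zero_of_prime {G : Type*} [AddCommGroup G] {N : ℕ} (hN : N.Prime)
    {n : ℤ} {R : G} (hR0 : R ≠ 0) (hRN : (N : ℤ) • R = 0) (hRn : n • R = 0) {X : G}
    (hX : (N : ℤ) • X = 0) : n • X = 0 := by
  by_cases hdvd : (N : ℤ) ∣ n
  · obtain ⟨c, rfl⟩ := hdvd
    rw [mul_comm, mul_zsmul, hX, zsmul_zero]
  · exfalso
    apply hR0
    have hprime : Prime (N : ℤ) := Int.prime_iff_natAbs_prime.mpr (by simpa using hN)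
    have hcop : IsCoprime (N : ℤ) n := hprime.irreducible.coprime_iff_not_dvd.mpr hdvd
    obtain ⟨a, b, hab⟩ := hcop
    calc R = (a * N + b * n) • R := by rw [hab, one_zsmul]
      _ = 0 := by rw [add_zsmul, mul_zsmul, hRN, zsmul_zero, mul_zsmul, hRn, zsmul_zero, add_zero]

end Lemmas

/-! ## §2 One link of Mazur's chain: the quotient `E' = E/μ_N` -/

section Step

variable {N : ℕ} [Fact N.Prime]

/-- **One link of the chain `E → E' → E'' → ⋯` of the Second reduction** (Mazur, p. 157:
"Forming the quotient `E' = E/μ_N`, we get another elliptic curve over `ℚ` and the image of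
`ℤ/N` provides `E'` with, again, a sub-Galois module `ℤ/N ⊂ E'`"). Let `E/ℚ` be an elliptic
curve, `Q ∈ E[N] ∖ {O}` fixed by `Γ_ℚ`, and `C` a `Γ_ℚ`-stable complement of `⟨Q⟩` in `E[N]`
(the "`μ_N`"). Then the quotient `E' = E/C` — an elliptic curve over `ℚ` with an isogeny
`g : E → E'` over `ℚ` of kernel `C` (Silverman, *AEC* III.4.12–4.13.2; the tree's PROVED
`exists_isogeny_ker_eq_and_comp_eq_nsmul_holds`) — carries the point `Q' = g Q ∈ E'[N]`, again
non-zero (`Q ∉ C`) and `Γ_ℚ`-fixed (`g` is defined over `ℚ`); and `g` kills a non-zero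
`N`-torsion point `R ∈ C` (`C ≠ 0` as `#E[N] = N² > N = #⟨Q⟩`).
[cite: Mazur1977, Ch. III §5, Second reduction, p. 157; SilvermanAEC2009, Prop. III.4.12 with Rem. III.4.13.2] -/
theorem exists_quotient_step (E : WeierstrassCurve ℚ) [E.IsElliptic] {Q : geomTorsion E N}
    (hQ0 : Q ≠ 0) (hQ : ∀ σ : absoluteGaloisGroup ℚ, σ • Q = Q)
    {C : AddSubgroup (geomTorsion E N)}
    (hC : ∀ σ : absoluteGaloisGroup ℚ, ∀ S ∈ C, σ • S ∈ C)
    (hcompl : IsCompl C (AddSubgroup.zmultiples Q)) :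
    ∃ (E' : WeierstrassCurve ℚ) (_ : E'.IsElliptic) (g : Isogeny E E') (Q' : geomTorsion E' N),
      (Q' : geomPoints E') = g (Q : geomPoints E) ∧ Q' ≠ 0 ∧
      (∀ σ : absoluteGaloisGroup ℚ, σ • Q' = Q') ∧
      ∃ R : geomPoints E, (N : ℤ) • R = 0 ∧ R ≠ 0 ∧ g R = 0 := by
  have hN : N.Prime := Fact.out
  haveI : NeZero (N : ℚ) := ⟨Nat.cast_ne_zero.mpr hN.ne_zero⟩
  haveI : Finite (geomTorsion E N) :=
    finite_torsionPoints_holds E (AlgebraicClosure ℚ) (n := (N : ℤ)) (by exact_mod_cast hN.ne_zero)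
  -- the complement as a finite `Γ_ℚ`-stable subgroup of `E(ℚ̄)`
  set S : AddSubgroup (geomPoints E) := C.map (geomTorsion E N).subtype with hS
  have hmemS : ∀ {x : geomPoints E}, x ∈ S ↔ ∃ c ∈ C, (c : geomPoints E) = x := by
    intro x
    rw [hS, AddSubgroup.mem_map]
    rfl
  have hSfin : (S : Set (geomPoints E)).Finite := by
    refine ((Set.toFinite (C : Set (geomTorsion E N))).image
      (fun c : geomTorsion E N ↦ (c : geomPoints E))).subset fun x hx ↦ ?_
    obtain ⟨c, hc, rfl⟩ := hmemS.mp hx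
    exact ⟨c, hc, rfl⟩
  have hSstab : ∀ (σ : absoluteGaloisGroup ℚ) (x : geomPoints E), x ∈ S → σ • x ∈ S := by
    intro σ x hx
    obtain ⟨c, hc, rfl⟩ := hmemS.mp hx
    exact hmemS.mpr ⟨σ • c, hC σ c hc, rfl⟩
  obtain ⟨E', hE', g, f, hker, -, -⟩ :=
    E.exists_isogeny_ker_eq_and_comp_eq_nsmul_holds S hSfin hSstab
  have hQN : (N : ℤ) • (Q : geomPoints E) = 0 := mem_torsionBy_iff.mp Q.2
  have hmem' : g (Q : geomPoints E) ∈ geomTorsion E' N := by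
    rw [mem_torsionBy_iff, ← map_zsmul, hQN, map_zero]
  refine ⟨E', hE', g, ⟨g Q, hmem'⟩, rfl, ?_, ?_, ?_⟩
  · -- `g Q ≠ O`: `Q ∉ C = ker g`
    intro h0
    have hgQ : g (Q : geomPoints E) = 0 := congrArg Subtype.val h0
    have hQS : (Q : geomPoints E) ∈ S := by
      rw [← hker]
      exact hgQ
    obtain ⟨c, hc, hcQ⟩ := hmemS.mp hQS
    obtain rfl : c = Q := Subtype.ext hcQ
    have h : c ∈ C ⊓ AddSubgroup.zmultiples c :=
      AddSubgroup.mem_inf.mpr ⟨hc, AddSubgroup.mem_zmultiples c⟩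
    rw [hcompl.inf_eq_bot, AddSubgroup.mem_bot] at h
    exact hQ0 h
  · -- `Γ_ℚ`-fixed: `g` is defined over `ℚ`
    intro σ
    apply Subtype.ext
    change σ • g (Q : geomPoints E) = g Q
    rw [← Isogeny.map_smul]
    exact congrArg g (congrArg Subtype.val (hQ σ))
  · -- a non-zero `R ∈ C = ker g`
    have hCne : C ≠ ⊥ := by
      intro hbot
      rw [hbot] at hcompl
      have htop : AddSubgroup.zmultiples Q = ⊤ := by
        have h := hcompl.sup_eq_top
        rwa [bot_sup_eq] at h
      have hcard : Nat.card (AddSubgroup.zmultiples Q) = Nat.card (geomTorsion E N) := by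
        rw [htop, AddSubgroup.card_top]
      rw [Nat.card_zmultiples, addOrderOf_eq_of_ne_zero E N hQ0, natCard_geomTorsion E N,
        sq] at hcard
      exact absurd (mul_right_cancel₀ hN.ne_zero ((one_mul N).trans hcard)) hN.one_lt.ne
    obtain ⟨⟨c, hc⟩, hc0⟩ := (AddSubgroup.ne_bot_iff_exists_ne_zero.mp hCne)
    refine ⟨c, mem_torsionBy_iff.mp c.2, fun h ↦ hc0 (Subtype.ext (Subtype.ext h)), ?_⟩
    have h : (c : geomPoints E) ∈ g.toAddMonoidHom.ker := by
      rw [hker]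
      exact hmemS.mpr ⟨c, hc, rfl⟩
    exact h

end Step

/-! ## §3 The Second reduction -/

section SecondReduction

variable (W : WeierstrassCurve ℚ) [W.IsElliptic] {N : ℕ} [Fact N.Prime]

/-- **Mazur 1977, Ch. III §5, the Second reduction, PROVED** (pp. 157–158: "It suffices to prove
that (5.4) splits, or equivalent, that `L = K`. For we would then have the following result from
which we easily derive a contradiction: *Given any elliptic curve `ℰ` and a sub-Galois module
`ℤ/N ⊂ ℰ`, there is a sub-Galois module `μ_N ⊂ ℰ`.* … Forming the quotient `ℰ' = ℰ/μ_N`, we get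
another elliptic curve over `ℚ` and the image of `ℤ/N` provides `ℰ'` with, again, a sub-Galois
module `ℤ/N ⊂ ℰ'`. We may then apply the above result inductively to obtain a chain of such
elliptic curves over `ℚ`, related by `μ_N`-isogenies, rational over `ℚ`: `ℰ → ℰ' → ℰ'' → ⋯`
all containing sub-Galois modules isomorphic to `ℤ/N`. This is impossible … the members of the
above chain cannot be all mutually nonisomorphic. For, if they were, they would represent an
infinite number of elliptic curves over `ℚ` with good reduction outside a given finite set of
primes. This would contradict the theorem of Shafarevitch … We have therefore shown that for
suitable `i ≠ j`, `ℰ^{(i)} ≅ ℰ^{(j)}` and consequently there is a non-scalar endomorphism of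
`ℰ^{(i)}` defined over `ℚ`. In particular, `ℰ^{(i)}` possesses a complex multiplication over
`ℚ`, which is impossible.").

**Statement.** Let `E/ℚ` be an elliptic curve with a rational point `P` of prime order `N`.
Suppose that for every elliptic curve `ℰ/ℚ` which is `ℚ`-isogenous to `E` and every non-zero
`Γ_ℚ`-fixed `Q ∈ ℰ[N]` ("a sub-Galois module `ℤ/N ⊂ ℰ`") the line `⟨Q⟩` has a `Γ_ℚ`-stable
complement in `ℰ[N]` ("there is a sub-Galois module `μ_N ⊂ ℰ`": by (5.4),
`smul_sub_cyclotomic_smul_mem_zmultiples`, a stable complement is a copy of `μ_N`, and the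
sequence (5.4) splits; this is the form in which the rest of Mazur's proof delivers the "result",
cf. `Mazur1977_splits_iff`). Then `False`.

**Proof** (the printed one, with its three inputs all PROVED in the tree): the chain is built
with the quotient isogenies `exists_isogeny_ker_eq_and_comp_eq_nsmul_holds` (*AEC* III.4.12,
`IsogenyQuotientCurveProofs`; one link is `exists_quotient_step`), by dependent choice; by
Shafarevich's theorem in the form *AEC* Cor. IX.6.2 (`finite_isogenyClass_holds`,
`IsogenyClassFiniteProofs`, from Siegel's theorem) two members `ℰ^{(i)}`, `ℰ^{(j)}`, `i < j`,
are `ℚ`-isomorphic, `ℰ^{(j)} = D • ℰ^{(i)}`; composing the chain `ℰ^{(i)} → ℰ^{(j)}` with this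
isomorphism gives an endomorphism `ψ` of `ℰ^{(i)}` defined over `ℚ`, which by
`not_hasRationalCM_holds` (`IsogenyNotRationalCMProofs`: no elliptic curve over `ℚ` has a
non-scalar `ℚ`-endomorphism, Silverman *ATAEC* II.2.2) is a scalar `[n]`. "Non-scalar" is
checked on the `N`-torsion: `ψ` kills the non-zero `N`-torsion point `R ∈ μ_N = ker(ℰ^{(i)} →
ℰ^{(i+1)})`, so `N ∣ n` and `ψ` kills `ℰ^{(i)}[N]`; but `ψ` maps the point `ℤ/N ∋ Q_i ↦ Q_j ≠ O`
injectively. [cite: Mazur1977, Ch. III §5, Second reduction, pp. 157–158; SilvermanAEC2009, Cor. IX.6.2 and Prop. III.4.12] -/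
theorem Mazur1977_secondReduction {P : W.toAffine.Point} (hP : addOrderOf P = N)
    (hsplit : ∀ (E : WeierstrassCurve ℚ) [E.IsElliptic], IsIsogenous W E →
      ∀ (Q : geomTorsion E N), Q ≠ 0 → (∀ σ : absoluteGaloisGroup ℚ, σ • Q = Q) →
        ∃ C : AddSubgroup (geomTorsion E N),
          (∀ σ : absoluteGaloisGroup ℚ, ∀ S ∈ C, σ • S ∈ C) ∧
            IsCompl C (AddSubgroup.zmultiples Q)) :
    False := by
  have hN : N.Prime := Fact.out
  -- the type of stages `(ℰ, ℤ/N ⊂ ℰ)` of the chain and the one-link relation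
  let T := { p : Σ E : WeierstrassCurve ℚ, geomTorsion E N //
    p.1.IsElliptic ∧ p.2 ≠ 0 ∧ (∀ σ : absoluteGaloisGroup ℚ, σ • p.2 = p.2) ∧ IsIsogenous W p.1 }
  let Rel : T → T → Prop := fun t t' ↦ ∃ g : Isogeny t.1.1 t'.1.1,
    g (t.1.2 : geomPoints t.1.1) = (t'.1.2 : geomPoints t'.1.1) ∧
      ∃ R : geomPoints t.1.1, (N : ℤ) • R = 0 ∧ R ≠ 0 ∧ g R = 0
  have hstep : ∀ t : T, ∃ t' : T, Rel t t' := by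
    rintro ⟨⟨E, Q⟩, hE, hQ0, hQ, hiso⟩
    haveI := hE
    obtain ⟨C, hC, hcompl⟩ := hsplit E hiso Q hQ0 hQ
    obtain ⟨E', hE', g, Q', hQ'g, hQ'0, hQ', R, hRN, hR0, hgR⟩ :=
      exists_quotient_step E hQ0 hQ hC hcompl
    exact ⟨⟨⟨E', Q'⟩, hE', hQ'0, hQ', hiso.trans' ⟨g⟩⟩, g, hQ'g.symm, R, hRN, hR0, hgR⟩
  -- the initial stage: `E = W` with the geometric point of `P`, and the chain (dependent choice)
  obtain ⟨Pb, -, hPb0, hfix⟩ := exists_geomTorsion_of_addOrderOf_eq W hP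
  let t₀ : T := ⟨⟨W, Pb⟩, inferInstance, hPb0, hfix, isIsogenous_self W⟩
  let f : ℕ → T := fun n ↦ Nat.rec t₀ (fun _ t ↦ Classical.choose (hstep t)) n
  have hf : ∀ n, Rel (f n) (f (n + 1)) := fun n ↦ Classical.choose_spec (hstep (f n))
  -- Shafarevich: finitely many `ℚ`-isomorphism classes in the `ℚ`-isogeny class of `W`
  have hfin : ∃ F : Finset (WeierstrassCurve ℚ), ∀ (W' : WeierstrassCurve ℚ) [W'.IsElliptic],
      IsIsogenous W W' → ∃ C : VariableChange ℚ, C • W' ∈ F := W.finite_isogenyClass_holds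
  obtain ⟨F, hF⟩ := hfin
  have hkey : ∀ n, ∃ M : F, ∃ C : VariableChange ℚ, C • (f n).1.1 = M := by
    intro n
    haveI := (f n).2.1
    obtain ⟨C, hC⟩ := hF (f n).1.1 (f n).2.2.2.2
    exact ⟨⟨_, hC⟩, C, rfl⟩
  choose key hkeyC using hkey
  obtain ⟨i, j, hne, hij⟩ := Finite.exists_ne_map_eq_of_infinite key
  -- two isomorphic members `ℰ^{(i)} ≅ ℰ^{(j)}`, `i < j`
  wlog hlt : i < j generalizing i j
  · exact this j i hne.symm hij.symm (lt_of_le_of_ne (not_lt.mp hlt) hne.symm)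
  obtain ⟨d, rfl⟩ : ∃ d, j = i + d + 1 := ⟨j - i - 1, by omega⟩
  obtain ⟨Ci, hCi⟩ := hkeyC i
  obtain ⟨Cj, hCj⟩ := hkeyC (i + d + 1)
  have hD : (Cj⁻¹ * Ci) • (f i).1.1 = (f (i + d + 1)).1.1 := by
    rw [mul_smul, hCi, hij, ← hCj, inv_smul_smul]
  obtain ⟨back, hback⟩ := exists_injective_isogeny_of_smul_eq hD
  -- the composite isogeny `ℰ^{(i)} → ℰ^{(j)}`: `Q_i ↦ Q_j`, and it kills `R ∈ μ_N ⊂ ℰ^{(i)}`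
  obtain ⟨g₀, hg₀Q, R, hRN, hR0, hg₀R⟩ := hf i
  have hchain : ∀ e : ℕ, ∃ Φ : Isogeny (f i).1.1 (f (i + e + 1)).1.1,
      Φ ((f i).1.2 : geomPoints (f i).1.1) = ((f (i + e + 1)).1.2 : geomPoints (f (i + e + 1)).1.1) ∧
        Φ R = 0 := by
    intro e
    induction e with
    | zero => exact ⟨g₀, hg₀Q, hg₀R⟩
    | succ e ih =>
      obtain ⟨Φ, hΦQ, hΦR⟩ := ih
      obtain ⟨g, hgQ, -⟩ := hf (i + e + 1)
      exact ⟨g.comp Φ, by rw [Isogeny.comp_apply, hΦQ, hgQ],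
        by rw [Isogeny.comp_apply, hΦR, map_zero]⟩
  obtain ⟨Φ, hΦQ, hΦR⟩ := hchain d
  -- the `ℚ`-endomorphism `ψ = back ∘ Φ` of `ℰ^{(i)}`
  haveI := (f i).2.1
  let ψ : Isogeny (f i).1.1 (f i).1.1 := back.comp Φ
  have hψR : ψ R = 0 := by
    change back (Φ R) = 0
    rw [hΦR, map_zero]
  have hψQ : ψ ((f i).1.2 : geomPoints (f i).1.1) ≠ 0 := by
    change back (Φ ((f i).1.2 : geomPoints (f i).1.1)) ≠ 0
    rw [hΦQ]
    intro h
    have h0 := hback (h.trans (map_zero back).symm)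
    exact (f (i + d + 1)).2.2.1 (Subtype.ext h0)
  -- no rational CM: `ψ = [n]`
  have hn : ∃ n : ℤ, (ψ.toAddMonoidHom : AddMonoid.End (geomPoints (f i).1.1)) =
      (n : AddMonoid.End (geomPoints (f i).1.1)) := by
    by_contra hcon
    push Not at hcon
    exact not_hasRationalCM_holds (f i).1.1 ⟨ψ.toAddMonoidHom, ψ.toAddMonoidHom_mem_endRing, hcon⟩
  obtain ⟨n, hn⟩ := hn
  have hψn : ∀ X : geomPoints (f i).1.1, ψ X = n • X := fun X ↦
    (congrArg (fun φ : AddMonoid.End (geomPoints (f i).1.1) ↦ φ X) hn).trans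
      (AddMonoid.End.intCast_apply n X)
  -- `ψ R = 0` forces `N ∣ n`, so `ψ` kills `Q_i`: contradiction
  have hQN : (N : ℤ) • ((f i).1.2 : geomPoints (f i).1.1) = 0 := mem_torsionBy_iff.mp (f i).1.2.2
  apply hψQ
  rw [hψn]
  exact zsmul_eq_zero_of_zsmul_eq_zero_of_prime hN hR0 hRN (by rw [← hψn]; exact hψR) hQN

/-- **The Second reduction in the form "it suffices that `L = K`"** (Mazur, p. 157: "It suffices
to prove that (5.4) splits, or equivalent, that `L = K`"). If, for every elliptic curve `ℰ/ℚ`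
which is `ℚ`-isogenous to `E` and every non-zero `Γ_ℚ`-fixed `Q ∈ ℰ[N]`, the group
`Γ_K = ker χ̄_N` (`K = ℚ(ζ_N)`) acts trivially on `ℰ[N]` (i.e. `L = ℚ(ℰ[N]) ⊆ K`), then `E(ℚ)`
has no point of prime order `N`: by `exists_stable_isCompl_zmultiples_iff` ("(5.4) splits iff
`L = K`", `MazurTorsionGaloisStructureProofs`) and `Mazur1977_secondReduction`.
[cite: Mazur1977, Ch. III §5, Second reduction, p. 157] -/
theorem Mazur1977_secondReduction_of_forall_smul_eq {P : W.toAffine.Point}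
    (hP : addOrderOf P = N)
    (hLK : ∀ (E : WeierstrassCurve ℚ) [E.IsElliptic], IsIsogenous W E →
      ∀ (Q : geomTorsion E N), Q ≠ 0 → (∀ σ : absoluteGaloisGroup ℚ, σ • Q = Q) →
        ∀ τ : absoluteGaloisGroup ℚ,
          Literature.NumberTheory.GaloisRepresentations.modPCyclotomicCharacterZMod ℚ N τ = 1 →
            ∀ S : geomTorsion E N, τ • S = S) :
    False := by
  have hN : N.Prime := Fact.out
  haveI : NeZero (N : ℚ) := ⟨Nat.cast_ne_zero.mpr hN.ne_zero⟩
  refine Mazur1977_secondReduction W hP fun E _ hiso Q hQ0 hQ ↦ ?_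
  exact (exists_stable_isCompl_zmultiples_iff E N hQ0 hQ).mpr (hLK E hiso Q hQ0 hQ)

omit [W.IsElliptic] in
/-- **What remains of the prime-case leaf after the Second reduction.** The leaf
`Mazur1977_no_prime_torsion W` (no rational point of prime order `N ∉ {2, 3, 5, 7, 13}` on an
elliptic curve `E = W` over `ℚ`) holds as soon as, for every prime `N ∉ {2, 3, 5, 7, 13}` and
every elliptic curve `ℰ` over `ℚ` which is `ℚ`-isogenous to `E` and carries a non-zero
`Γ_ℚ`-fixed point of `ℰ[N]` ("`ℤ/N ⊂ ℰ`"), the group `Γ_{ℚ(ζ_N)}` acts trivially on `ℰ[N]`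
("`L = K`") — the statement which Mazur's Third reduction and Steps 1–4 (pp. 158–160)
establish. (PROVED reduction; the inputs Shafarevich IX.6.2, the quotient isogenies III.4.12
and "no CM over `ℚ`" are theorems of the tree.)
[cite: Mazur1977, Ch. III §5, Second reduction, pp. 157–158] -/
theorem Mazur1977_no_prime_torsion_of_forall_smul_eq
    (hLK : ∀ (N : ℕ) [Fact N.Prime], N ∉ ({2, 3, 5, 7, 13} : Finset ℕ) →
      ∀ (E : WeierstrassCurve ℚ) [E.IsElliptic], IsIsogenous W E →
        ∀ (Q : geomTorsion E N), Q ≠ 0 → (∀ σ : absoluteGaloisGroup ℚ, σ • Q = Q) →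
          ∀ τ : absoluteGaloisGroup ℚ,
            Literature.NumberTheory.GaloisRepresentations.modPCyclotomicCharacterZMod ℚ N τ = 1 →
              ∀ S : geomTorsion E N, τ • S = S) :
    Mazur1977_no_prime_torsion W := by
  intro _ N hN hNS hex
  obtain ⟨P, hP⟩ := hex
  haveI : Fact N.Prime := ⟨hN⟩
  exact Mazur1977_secondReduction_of_forall_smul_eq W hP (hLK N hNS)

omit [W.IsElliptic] in
/-- **Galois descent for the point "`ℤ/N ⊂ ℰ`"**: a non-zero `Γ_ℚ`-fixed point of `ℰ[N]` is the
geometric point of a rational point of `ℰ(ℚ)` of order `N` (Silverman, *AEC* VIII.§1,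
`E(K̄)^{G_K} = E(K)` for `K` perfect; the tree's PROVED `fixedPoints_eq_range_map_holds`).
[cite: SilvermanAEC2009, VIII.§1 (proof of Prop. 1.2)] -/
theorem exists_addOrderOf_eq_of_smul_eq (E : WeierstrassCurve ℚ) {Q : geomTorsion E N}
    (hQ0 : Q ≠ 0) (hQ : ∀ σ : absoluteGaloisGroup ℚ, σ • Q = Q) :
    ∃ P : E.toAffine.Point, addOrderOf P = N ∧
      Affine.Point.map (W' := E.toAffine) (S := ℚ) (Algebra.ofId ℚ (AlgebraicClosure ℚ)) P =
        (Q : geomPoints E) := by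
  have hfix : (Q : geomPoints E) ∈
      MulAction.fixedPoints (absoluteGaloisGroup ℚ) (geomPoints E) := by
    rw [MulAction.mem_fixedPoints]
    intro σ
    exact congrArg Subtype.val (hQ σ)
  have h : MulAction.fixedPoints (absoluteGaloisGroup ℚ) (geomPoints E) =
      Set.range (fun P : (E.baseChange ℚ).toAffine.Point ↦
        (Affine.Point.baseChange ℚ (AlgebraicClosure ℚ) P : geomPoints E)) :=
    fixedPoints_eq_range_map_holds E
  rw [h] at hfix
  obtain ⟨P, hP⟩ := hfix
  refine ⟨P, ?_, hP⟩
  have h1 : addOrderOf (Affine.Point.map (W' := E.toAffine) (S := ℚ)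
      (Algebra.ofId ℚ (AlgebraicClosure ℚ)) P) = addOrderOf P :=
    addOrderOf_injective _ (Affine.Point.map_injective (W' := E.toAffine)
      (f := Algebra.ofId ℚ (AlgebraicClosure ℚ))) P
  have h2 : addOrderOf (Q : geomPoints E) = addOrderOf Q :=
    addOrderOf_injective (geomTorsion E N).subtype Subtype.coe_injective Q
  have hP' : Affine.Point.map (W' := E.toAffine) (S := ℚ)
      (Algebra.ofId ℚ (AlgebraicClosure ℚ)) P = (Q : geomPoints E) := hP
  exact h1.symm.trans ((congrArg addOrderOf hP').trans
    (h2.trans (addOrderOf_eq_of_ne_zero E N hQ0)))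

omit [W.IsElliptic] in
/-- **The prime-case leaf reduced to "`L = K`", rational-point form.** `Mazur1977_no_prime_torsion W`
holds as soon as: for every prime `N ∉ {2, 3, 5, 7, 13}` and every elliptic curve `ℰ/ℚ` which is
`ℚ`-isogenous to `W` and has a rational point of order `N`, the group `Γ_{ℚ(ζ_N)} = ker χ̄_N`
acts trivially on `ℰ[N]` ("`L = K`" for `ℰ`). This is Mazur's "Second reduction. — It suffices
to prove that (5.4) splits, or equivalent, that `L = K`" (p. 157) made into a theorem: what the
Third reduction and Steps 1–4 of pp. 158–160 prove for every "`ℤ/N ⊂ E`" is exactly the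
hypothesis. [cite: Mazur1977, Ch. III §5, Second reduction, pp. 157–158] -/
theorem Mazur1977_no_prime_torsion_of_forall_addOrderOf
    (hLK : ∀ (N : ℕ) [Fact N.Prime], N ∉ ({2, 3, 5, 7, 13} : Finset ℕ) →
      ∀ (E : WeierstrassCurve ℚ) [E.IsElliptic], IsIsogenous W E →
        (∃ P : E.toAffine.Point, addOrderOf P = N) →
          ∀ τ : absoluteGaloisGroup ℚ,
            Literature.NumberTheory.GaloisRepresentations.modPCyclotomicCharacterZMod ℚ N τ = 1 →
              ∀ S : geomTorsion E N, τ • S = S) :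
    Mazur1977_no_prime_torsion W := by
  refine Mazur1977_no_prime_torsion_of_forall_smul_eq W fun N _ hNS E _ hiso Q hQ0 hQ ↦ ?_
  obtain ⟨P, hP, -⟩ := exists_addOrderOf_eq_of_smul_eq E hQ0 hQ
  exact hLK N hNS E hiso ⟨P, hP⟩

end SecondReduction

end Literature.NumberTheory.EllipticCurves

end
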